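import Literature.Probability.RandomPlanarGeometry.SAWLoopErasureMemoryTwoFirstHit
import HarnessLib

/-!
# Hara–Slade–Sokal §3.2–3.3 at the generating-function level: (3.12), (3.13), (3.18) as identities of
convergent series for `0 ≤ β ≤ 1/(2d−1)`, `d ≥ 3`

Source, AS PRINTED (Hara, Slade and Sokal, J. Stat. Phys. 72 (1993) 479–517 = arXiv:hep-lat/9302003, §3.2
p. 17–18 and §3.3 p. 19):

* (3.12) `Σ_{ω₂: b→x, ω₂∩A=∅} β^{|ω₂|} I[ω₂(1) ≠ b+f] = (1/(1−β²))·[C^A₂(b,x;β) − β·C^A₂(b+f,x;β)]`;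
* (3.13) `C^{A∪{b}}₂(y,x;β) = C^A₂(y,x;β) − (β/(1−β²)) Σ_{f:|f|=1} C^{A∪{b}}₂(y,b+f;β)·[C^A₂(b,x;β) − β·C^A₂(b+f,x;β)]`,
  "for a fixed `y`, (3.13) provides a systems of `2d` linear equations for `2d` unknowns, namely
  `{C^{A∪{b}}₂(y,b+f;β)}_{|f|=1}`. Once we know these `2d` quantities by solving the equations, then everything on
  the right hand side of (3.13) is known";
* (3.18) `C̃^{A;e}₂(0,0;β) = (1/(1−β²))·[C^A₂(0,0;β) − β·C^A₂(0,e;β)]`, "and hence the bound (2.39) can be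
  computed once we know the values of `C^A₂(0,0;1/(2d−1))` and `C^A₂(0,e;1/(2d−1))`."

The pool cars `SAWLoopErasureMemoryTwoPenultimate` ((3.16)–(3.18)), `SAWLoopErasureMemoryTwoFirstStep`
((3.12)) and `SAWLoopErasureMemoryTwoFirstHit` ((3.10)–(3.11)) prove these identities EXACTLY at the level of
coefficients / truncated power series, for every `β`. This module passes to the limit: for `d ≥ 3` and
`0 ≤ β ≤ 1/(2d−1)` every series involved converges — its coefficients are dominated by the non-backtracking
two-point coefficients `b_n(x)`, whose series converges at the threshold `1/(2d−1)` by the tree's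
`summable_nbwCountR_threshold` (`NobleF3InitialPoint`) — and the identities hold for the sums
`tabooGF A x β = Σ_n #nbwAvoidTo A x n βⁿ` (= `C^A₂(0,x;β)`), `tabooFirstGF A x f β` (the left side of (3.12),
translated to start at the origin) and `penGF A s β = Σ_σ #closedNbwPen A s σ β^σ` (= `C̃^{A;e_s}₂(0,0;β)`):
`hss_penGF_eq` ((3.18)), `hss_tabooFirstGF_eq` ((3.12)), `tabooGF_eq_insert_add` ((3.10)–(3.11) summed, the
double series being a Cauchy product) and `hss_tabooGF_insert` ((3.13)). With no obstacle `tabooGF ∅ x β` is the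
tree's non-backtracking two-point series `nbwGen d β x`, so (3.13) with `A = ∅`, `y = 0`, `b = e_t` is an explicit
linear relation among the numbers `C^{e_t}₂(0,·;β)` with coefficients built from `nbwGen d β`
(`tabooGF_singleton_eq`): the `2d × 2d` system of [HSS93, §3.2] behind the (2̃,1) rows of Table 2, whose output
`C̃^{e_t;e_s}₂(0,0;1/(2d−1))` (`penGF_singleton_eq`, `sum_range_card_closedNbwPen_le_penGF`) is the `W` of (2.39).
-/

noncomputable section

namespace Literature.Probability.RandomPlanarGeometry.SAW.Zd.LoopErasure

open Finset Filter Topology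
open scoped BigOperators Topology
open Literature.Probability.LatticeModels Literature.Probability.LatticeModels.SRW
open Literature.Probability.Percolation (IsNBW nbwWords nbwWordsTo mem_nbwWords srev srev_srev)
open Literature.Probability.FitznerVanDerHofstad2017 (nbwCountR nbwCountR_nonneg nbwGen
  summable_nbwCountR_threshold wordPos_eq_endpoint)

variable {d : ℕ}

/-! ### No obstacle: `nbwAvoidTo ∅ x n` is the tree's `nbwWordsTo d n x` -/

/-- With `A = ∅` the constrained walks are all non-backtracking walks to `x`: `nbwAvoidTo ∅ x n = nbwWordsTo d n x`.
[cite: HaraSladeSokal1993, §3.2 p. 17 ("C₂ ≡ C^∅₂"; lane plumbing)] -/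
theorem nbwAvoidTo_empty_eq_nbwWordsTo (x : Site d) (n : ℕ) :
    nbwAvoidTo (∅ : Finset (Site d)) x n = nbwWordsTo d n x := by
  classical
  ext ω
  rw [mem_nbwAvoidTo, nbwWordsTo, Finset.mem_filter, mem_nbwWords, wordPos_eq_endpoint]
  constructor
  · rintro ⟨⟨hN, -⟩, hx⟩
    exact ⟨hN, hx⟩
  · rintro ⟨hN, hx⟩
    exact ⟨⟨hN, fun t _ h => Finset.notMem_empty _ h⟩, hx⟩

/-- `#nbwAvoidTo ∅ x n = b_n(x)` (`nbwCountR`). [cite: HaraSladeSokal1993, §3.2 p. 17 ("C₂ ≡ C^∅₂"; lane plumbing)] -/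
theorem card_nbwAvoidTo_empty (x : Site d) (n : ℕ) :
    (((nbwAvoidTo (∅ : Finset (Site d)) x n).card : ℕ) : ℝ) = nbwCountR d n x := by
  rw [nbwAvoidTo_empty_eq_nbwWordsTo]
  rfl

/-! ### Monotonicity in the obstacle and domination by `b_n(x)` -/

/-- Enlarging the obstacle shrinks the set of walks: `B ⊆ A → nbwAvoidTo A x n ⊆ nbwAvoidTo B x n`.
[cite: HaraSladeSokal1993, §3.2 eq. (3.10) p. 17 (lane plumbing)] -/
theorem nbwAvoidTo_subset_of_subset {A B : Finset (Site d)} (h : B ⊆ A) (x : Site d) (n : ℕ) :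
    nbwAvoidTo A x n ⊆ nbwAvoidTo B x n := by
  intro ω hω
  rw [mem_nbwAvoidTo] at hω ⊢
  exact ⟨⟨hω.1.1, fun t ht hB => hω.1.2 t ht (h hB)⟩, hω.2⟩

/-- `#nbwAvoidTo A x n ≤ b_n(x)`. [cite: HaraSladeSokal1993, §3.2 eq. (3.10) p. 17 (lane plumbing)] -/
theorem card_nbwAvoidTo_le_nbwCountR (A : Finset (Site d)) (x : Site d) (n : ℕ) :
    ((nbwAvoidTo A x n).card : ℝ) ≤ nbwCountR d n x := by
  rw [← card_nbwAvoidTo_empty]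
  exact_mod_cast Finset.card_le_card (nbwAvoidTo_subset_of_subset (Finset.empty_subset A) x n)

/-- `#nbwAvoidToFirst A x f n ≤ #nbwAvoidTo A x n`. [cite: HaraSladeSokal1993, §3.2 eq. (3.12) p. 18 (lane plumbing)] -/
theorem card_nbwAvoidToFirst_le_card (A : Finset (Site d)) (x : Site d) (f : Dir d) (n : ℕ) :
    (nbwAvoidToFirst A x f n).card ≤ (nbwAvoidTo A x n).card := by
  classical
  exact Finset.card_filter_le _ _

/-- `#closedNbwPen A s σ ≤ #nbwAvoidTo A 0 σ`. [cite: HaraSladeSokal1993, §3.3 eq. (3.16) p. 19 (lane plumbing)] -/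
theorem card_closedNbwPen_le_card_nbwAvoidTo (A : Finset (Site d)) (s : Dir d) (σ : ℕ) :
    (closedNbwPen A s σ).card ≤ (nbwAvoidTo A 0 σ).card := by
  have h := card_closedNbwPen_add_card_closedNbwLast A s σ
  omega

/-! ### Convergence for `0 ≤ β ≤ 1/(2d−1)`, `d ≥ 3` -/

/-- The obstacle series `Σ_n #nbwAvoidTo A x n βⁿ` converges for `0 ≤ β ≤ 1/(2d−1)` (`d ≥ 3`), by comparison with
the non-backtracking two-point series at the threshold. [cite: HaraSladeSokal1993, §3.2 eq. (3.9) p. 17 (the series at β = μ'⁻¹ ≤ 1/(2d−1))] -/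
theorem summable_card_nbwAvoidTo_mul_pow (hd : 3 ≤ d) (A : Finset (Site d)) (x : Site d) {β : ℝ}
    (hβ : 0 ≤ β) (hβc : β ≤ 1 / (2 * d - 1)) :
    Summable fun n => ((nbwAvoidTo A x n).card : ℝ) * β ^ n := by
  refine Summable.of_nonneg_of_le (fun n => mul_nonneg (Nat.cast_nonneg _) (pow_nonneg hβ n))
    (fun n => ?_) (summable_nbwCountR_threshold hd x)
  rw [mul_comm]
  exact mul_le_mul (pow_le_pow_left₀ hβ hβc n) (card_nbwAvoidTo_le_nbwCountR A x n) (Nat.cast_nonneg _)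
    (pow_nonneg (hβ.trans hβc) n)

/-- The first-step-constrained series converges for `0 ≤ β ≤ 1/(2d−1)` (`d ≥ 3`).
[cite: HaraSladeSokal1993, §3.2 eq. (3.12) p. 18 (the series at β ≤ 1/(2d−1))] -/
theorem summable_card_nbwAvoidToFirst_mul_pow (hd : 3 ≤ d) (A : Finset (Site d)) (x : Site d) (f : Dir d)
    {β : ℝ} (hβ : 0 ≤ β) (hβc : β ≤ 1 / (2 * d - 1)) :
    Summable fun n => ((nbwAvoidToFirst A x f n).card : ℝ) * β ^ n := by
  refine Summable.of_nonneg_of_le (fun n => mul_nonneg (Nat.cast_nonneg _) (pow_nonneg hβ n))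
    (fun n => ?_) (summable_card_nbwAvoidTo_mul_pow hd A x hβ hβc)
  exact mul_le_mul_of_nonneg_right (by exact_mod_cast card_nbwAvoidToFirst_le_card A x f n) (pow_nonneg hβ n)

/-- The penalised-loop series `Σ_σ #closedNbwPen A s σ β^σ` converges for `0 ≤ β ≤ 1/(2d−1)` (`d ≥ 3`).
[cite: HaraSladeSokal1993, §3.3 eq. (3.18) p. 19 (the series at β ≤ 1/(2d−1))] -/
theorem summable_card_closedNbwPen_mul_pow (hd : 3 ≤ d) (A : Finset (Site d)) (s : Dir d) {β : ℝ}
    (hβ : 0 ≤ β) (hβc : β ≤ 1 / (2 * d - 1)) :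
    Summable fun σ => ((closedNbwPen A s σ).card : ℝ) * β ^ σ := by
  refine Summable.of_nonneg_of_le (fun n => mul_nonneg (Nat.cast_nonneg _) (pow_nonneg hβ n))
    (fun n => ?_) (summable_card_nbwAvoidTo_mul_pow hd A 0 hβ hβc)
  exact mul_le_mul_of_nonneg_right (by exact_mod_cast card_closedNbwPen_le_card_nbwAvoidTo A s n)
    (pow_nonneg hβ n)

/-! ### The generating functions -/

/-- `C^A₂(0,x;β) = Σ_n #nbwAvoidTo A x n βⁿ`, the two-point function of memory-2 walks from `0` to `x` avoiding `A`.
[cite: HaraSladeSokal1993, §3.2 eq. (3.2) p. 16 and (3.10) p. 17] -/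
def tabooGF (A : Finset (Site d)) (x : Site d) (β : ℝ) : ℝ := ∑' n, ((nbwAvoidTo A x n).card : ℝ) * β ^ n

/-- `Σ_n #nbwAvoidToFirst A x f n βⁿ`: the generating function of memory-2 walks `0 → x` avoiding `A` whose first
step is not `f` (the left side of (3.12), translated to start at the origin). [cite: HaraSladeSokal1993, §3.2 eq. (3.12) p. 18] -/
def tabooFirstGF (A : Finset (Site d)) (x : Site d) (f : Dir d) (β : ℝ) : ℝ :=
  ∑' n, ((nbwAvoidToFirst A x f n).card : ℝ) * β ^ n

/-- `C̃^{A;e_s}₂(0,0;β) = Σ_σ #closedNbwPen A s σ β^σ`, the closed-loop generating function with the next-to-last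
site `e_s` excluded. [cite: HaraSladeSokal1993, §3.3 eq. (3.16) p. 19] -/
def penGF (A : Finset (Site d)) (s : Dir d) (β : ℝ) : ℝ := ∑' σ, ((closedNbwPen A s σ).card : ℝ) * β ^ σ

/-- `C^∅₂(0,x;β)` is the tree's non-backtracking two-point series `nbwGen d β x`. [cite: HaraSladeSokal1993, §3.2 p. 17 ("C₂ ≡ C^∅₂")] -/
theorem tabooGF_empty_eq_nbwGen (x : Site d) (β : ℝ) : tabooGF (∅ : Finset (Site d)) x β = nbwGen d β x := by
  unfold tabooGF nbwGen
  exact tsum_congr fun n => by rw [card_nbwAvoidTo_empty, mul_comm]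

/-- Partial sums over `range (K + j)` of a summable real series tend to its sum. [cite: HaraSladeSokal1993, §3.2 eq. (3.12)–(3.13) p. 18 (lane plumbing: passage to the limit)] -/
theorem tendsto_sum_range_add_of_summable {u : ℕ → ℝ} (hu : Summable u) (j : ℕ) :
    Tendsto (fun K : ℕ => ∑ n ∈ range (K + j), u n) atTop (𝓝 (∑' n, u n)) :=
  hu.hasSum.tendsto_sum_nat.comp (tendsto_add_atTop_nat j)

/-! ### (3.18) at the generating-function level -/

/-- **(3.18), summed:** `C̃^{A;e_s}₂(0,0;β) + β C^A₂(0,e_s;β) = C^A₂(0,0;β) + β² C̃^{A;e_s}₂(0,0;β)` for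
`0 ≤ β ≤ 1/(2d−1)`, `d ≥ 3`, `0 ∉ A`, `e_s ∉ A` (the limit of the pool car's `sum_closedNbwPen_add_two_eq`).
[cite: HaraSladeSokal1993, §3.3 eq. (3.17)–(3.18) p. 19] -/
theorem penGF_add_eq (hd : 3 ≤ d) {A : Finset (Site d)} (h0 : (0 : Site d) ∉ A) {s : Dir d}
    (hs : stepVec s ∉ A) {β : ℝ} (hβ : 0 ≤ β) (hβc : β ≤ 1 / (2 * d - 1)) :
    penGF A s β + β * tabooGF A (stepVec s) β = tabooGF A 0 β + β ^ 2 * penGF A s β := by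
  have hP := summable_card_closedNbwPen_mul_pow hd A s hβ hβc
  have hQ := summable_card_nbwAvoidTo_mul_pow hd A (stepVec s) hβ hβc
  have hA := summable_card_nbwAvoidTo_mul_pow hd A 0 hβ hβc
  have h1 : Tendsto (fun K : ℕ => ∑ σ ∈ range (K + 3), ((closedNbwPen A s σ).card : ℝ) * β ^ σ +
      β * ∑ σ ∈ range (K + 2), ((nbwAvoidTo A (stepVec s) σ).card : ℝ) * β ^ σ) atTop
      (𝓝 (penGF A s β + β * tabooGF A (stepVec s) β)) :=
    (tendsto_sum_range_add_of_summable hP 3).add ((tendsto_sum_range_add_of_summable hQ 2).const_mul β)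
  have h2 : Tendsto (fun K : ℕ => ∑ σ ∈ range (K + 3), ((nbwAvoidTo A 0 σ).card : ℝ) * β ^ σ +
      β ^ 2 * ∑ σ ∈ range (K + 1), ((closedNbwPen A s σ).card : ℝ) * β ^ σ) atTop
      (𝓝 (tabooGF A 0 β + β ^ 2 * penGF A s β)) :=
    (tendsto_sum_range_add_of_summable hA 3).add ((tendsto_sum_range_add_of_summable hP 1).const_mul (β ^ 2))
  have heq : (fun K : ℕ => ∑ σ ∈ range (K + 3), ((closedNbwPen A s σ).card : ℝ) * β ^ σ +
      β * ∑ σ ∈ range (K + 2), ((nbwAvoidTo A (stepVec s) σ).card : ℝ) * β ^ σ) =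
      fun K : ℕ => ∑ σ ∈ range (K + 3), ((nbwAvoidTo A 0 σ).card : ℝ) * β ^ σ +
        β ^ 2 * ∑ σ ∈ range (K + 1), ((closedNbwPen A s σ).card : ℝ) * β ^ σ :=
    funext fun K => sum_closedNbwPen_add_two_eq h0 hs β K
  rw [heq] at h1
  exact tendsto_nhds_unique h1 h2

/-- **(3.18):** `C̃^{A;e}₂(0,0;β) = (1/(1−β²))·[C^A₂(0,0;β) − β·C^A₂(0,e;β)]` (`e = e_s`), written as
`(1 − β²)·C̃^{A;e_s}₂(0,0;β) = C^A₂(0,0;β) − β C^A₂(0,e_s;β)`, for `0 ≤ β ≤ 1/(2d−1)`, `d ≥ 3`, `0, e_s ∉ A`.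
[cite: HaraSladeSokal1993, §3.3 eq. (3.18) p. 19] -/
theorem hss_penGF_eq (hd : 3 ≤ d) {A : Finset (Site d)} (h0 : (0 : Site d) ∉ A) {s : Dir d}
    (hs : stepVec s ∉ A) {β : ℝ} (hβ : 0 ≤ β) (hβc : β ≤ 1 / (2 * d - 1)) :
    (1 - β ^ 2) * penGF A s β = tabooGF A 0 β - β * tabooGF A (stepVec s) β := by
  have h := penGF_add_eq hd h0 hs hβ hβc
  linear_combination h

/-! ### (3.12) at the generating-function level -/

/-- **(3.12), summed:** `N + β C^{A−e_f}₂(0,x−e_f;β) = C^A₂(0,x;β) + β² N` with `N = tabooFirstGF A x f β`, for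
`0 ≤ β ≤ 1/(2d−1)`, `d ≥ 3`, `0, e_f ∉ A` (the limit of the pool car's `sum_nbwAvoidToFirst_add_two_eq`).
[cite: HaraSladeSokal1993, §3.2 eq. (3.12) p. 18] -/
theorem tabooFirstGF_add_eq (hd : 3 ≤ d) {A : Finset (Site d)} (h0 : (0 : Site d) ∉ A) {f : Dir d}
    (hf : stepVec f ∉ A) (x : Site d) {β : ℝ} (hβ : 0 ≤ β) (hβc : β ≤ 1 / (2 * d - 1)) :
    tabooFirstGF A x f β + β * tabooGF (tabooShift A f) (x - stepVec f) β =
      tabooGF A x β + β ^ 2 * tabooFirstGF A x f β := by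
  have hN := summable_card_nbwAvoidToFirst_mul_pow hd A x f hβ hβc
  have hC' := summable_card_nbwAvoidTo_mul_pow hd (tabooShift A f) (x - stepVec f) hβ hβc
  have hC := summable_card_nbwAvoidTo_mul_pow hd A x hβ hβc
  have h1 : Tendsto (fun K : ℕ => ∑ n ∈ range (K + 3), ((nbwAvoidToFirst A x f n).card : ℝ) * β ^ n +
      β * ∑ n ∈ range (K + 2), ((nbwAvoidTo (tabooShift A f) (x - stepVec f) n).card : ℝ) * β ^ n) atTop
      (𝓝 (tabooFirstGF A x f β + β * tabooGF (tabooShift A f) (x - stepVec f) β)) :=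
    (tendsto_sum_range_add_of_summable hN 3).add ((tendsto_sum_range_add_of_summable hC' 2).const_mul β)
  have h2 : Tendsto (fun K : ℕ => ∑ n ∈ range (K + 3), ((nbwAvoidTo A x n).card : ℝ) * β ^ n +
      β ^ 2 * ∑ n ∈ range (K + 1), ((nbwAvoidToFirst A x f n).card : ℝ) * β ^ n) atTop
      (𝓝 (tabooGF A x β + β ^ 2 * tabooFirstGF A x f β)) :=
    (tendsto_sum_range_add_of_summable hC 3).add ((tendsto_sum_range_add_of_summable hN 1).const_mul (β ^ 2))
  have heq : (fun K : ℕ => ∑ n ∈ range (K + 3), ((nbwAvoidToFirst A x f n).card : ℝ) * β ^ n +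
      β * ∑ n ∈ range (K + 2), ((nbwAvoidTo (tabooShift A f) (x - stepVec f) n).card : ℝ) * β ^ n) =
      fun K : ℕ => ∑ n ∈ range (K + 3), ((nbwAvoidTo A x n).card : ℝ) * β ^ n +
        β ^ 2 * ∑ n ∈ range (K + 1), ((nbwAvoidToFirst A x f n).card : ℝ) * β ^ n :=
    funext fun K => sum_nbwAvoidToFirst_add_two_eq h0 hf x β K
  rw [heq] at h1
  exact tendsto_nhds_unique h1 h2

/-- **(3.12):** `Σ_{ω₂: b→x, ω₂∩A=∅} β^{|ω₂|} I[ω₂(1) ≠ b+f] = (1/(1−β²))·[C^A₂(b,x;β) − β·C^A₂(b+f,x;β)]`,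
translated to start at the origin (`b ↦ 0`, `A ↦ A − b`, first step `f`) and written as
`(1 − β²)·N = C^A₂(0,x;β) − β·C^{A−e_f}₂(0,x−e_f;β)` with `N = tabooFirstGF A x f β`, for `0 ≤ β ≤ 1/(2d−1)`,
`d ≥ 3`, `0, e_f ∉ A`. [cite: HaraSladeSokal1993, §3.2 eq. (3.12) p. 18] -/
theorem hss_tabooFirstGF_eq (hd : 3 ≤ d) {A : Finset (Site d)} (h0 : (0 : Site d) ∉ A) {f : Dir d}
    (hf : stepVec f ∉ A) (x : Site d) {β : ℝ} (hβ : 0 ≤ β) (hβc : β ≤ 1 / (2 * d - 1)) :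
    (1 - β ^ 2) * tabooFirstGF A x f β = tabooGF A x β - β * tabooGF (tabooShift A f) (x - stepVec f) β := by
  have h := tabooFirstGF_add_eq hd h0 hf x hβ hβc
  linear_combination h

/-! ### (3.10)–(3.11) at the generating-function level, and (3.13) -/

/-- **(3.10)–(3.11), summed:** `C^A₂(0,x;β) = C^{A∪{b}}₂(0,x;β) + β Σ_g C^{A∪{b}}₂(0,b−e_g;β) · N_g` with
`N_g = tabooFirstGF (A − b) (x − b) (−g) β` the series of the walks after the first hit of `b` (first step `≠ −g`,
translated to the origin), for `0 ≤ β ≤ 1/(2d−1)`, `d ≥ 3`, `b ≠ 0`, `b ∉ A` (the limit of the pool car's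
`sum_card_nbwAvoidTo_mul_pow_eq`, the double series being a Cauchy product).
[cite: HaraSladeSokal1993, §3.2 eq. (3.10)–(3.11) p. 17–18] -/
theorem tabooGF_eq_insert_add (hd : 3 ≤ d) {A : Finset (Site d)} {b : Site d} (hb0 : b ≠ 0) (hbA : b ∉ A)
    (x : Site d) {β : ℝ} (hβ : 0 ≤ β) (hβc : β ≤ 1 / (2 * d - 1)) :
    tabooGF A x β = tabooGF (insert b A) x β +
      β * ∑ g : Dir d, tabooGF (insert b A) (b - stepVec g) β *
        tabooFirstGF (tabooShiftBy A b) (x - b) (srev g) β := by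
  have hC := summable_card_nbwAvoidTo_mul_pow hd A x hβ hβc
  have hCb := summable_card_nbwAvoidTo_mul_pow hd (insert b A) x hβ hβc
  -- the Cauchy products, one for each direction `g`
  have hprod : ∀ g : Dir d, Tendsto (fun K : ℕ => ∑ n ∈ range (K + 1), ∑ m ∈ range (n + 1),
      ((nbwAvoidTo (insert b A) (b - stepVec g) m).card : ℝ) * β ^ m *
        (((nbwAvoidToFirst (tabooShiftBy A b) (x - b) (srev g) (n - m)).card : ℝ) * β ^ (n - m))) atTop
      (𝓝 (tabooGF (insert b A) (b - stepVec g) β * tabooFirstGF (tabooShiftBy A b) (x - b) (srev g) β)) := by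
    intro g
    have hf := summable_card_nbwAvoidTo_mul_pow hd (insert b A) (b - stepVec g) hβ hβc
    have hg := summable_card_nbwAvoidToFirst_mul_pow hd (tabooShiftBy A b) (x - b) (srev g) hβ hβc
    have h := (hasSum_sum_range_mul_of_summable_norm
      (hf.congr fun n =>
        (Real.norm_of_nonneg (mul_nonneg (Nat.cast_nonneg _) (pow_nonneg hβ n))).symm)
      (hg.congr fun n =>
        (Real.norm_of_nonneg (mul_nonneg (Nat.cast_nonneg _) (pow_nonneg hβ n))).symm)).tendsto_sum_nat
    exact h.comp (tendsto_add_atTop_nat 1)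
  have h1 : Tendsto (fun K : ℕ => ∑ n ∈ range (K + 2), ((nbwAvoidTo A x n).card : ℝ) * β ^ n) atTop
      (𝓝 (tabooGF A x β)) := tendsto_sum_range_add_of_summable hC 2
  have h2 : Tendsto (fun K : ℕ => ∑ n ∈ range (K + 2), ((nbwAvoidTo (insert b A) x n).card : ℝ) * β ^ n +
      β * ∑ g : Dir d, ∑ n ∈ range (K + 1), ∑ m ∈ range (n + 1),
        ((nbwAvoidTo (insert b A) (b - stepVec g) m).card : ℝ) * β ^ m *
          (((nbwAvoidToFirst (tabooShiftBy A b) (x - b) (srev g) (n - m)).card : ℝ) * β ^ (n - m))) atTop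
      (𝓝 (tabooGF (insert b A) x β + β * ∑ g : Dir d, tabooGF (insert b A) (b - stepVec g) β *
        tabooFirstGF (tabooShiftBy A b) (x - b) (srev g) β)) :=
    (tendsto_sum_range_add_of_summable hCb 2).add ((tendsto_finsetSum _ fun g _ => hprod g).const_mul β)
  have heq : (fun K : ℕ => ∑ n ∈ range (K + 2), ((nbwAvoidTo A x n).card : ℝ) * β ^ n) =
      fun K : ℕ => ∑ n ∈ range (K + 2), ((nbwAvoidTo (insert b A) x n).card : ℝ) * β ^ n +
        β * ∑ g : Dir d, ∑ n ∈ range (K + 1), ∑ m ∈ range (n + 1),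
          ((nbwAvoidTo (insert b A) (b - stepVec g) m).card : ℝ) * β ^ m *
            (((nbwAvoidToFirst (tabooShiftBy A b) (x - b) (srev g) (n - m)).card : ℝ) * β ^ (n - m)) := by
    funext K
    rw [sum_card_nbwAvoidTo_mul_pow_eq hb0 hbA x β K]
    congr 2
    refine Finset.sum_congr rfl fun g _ => ?_
    exact (sum_sum_range_convolution K (fun m => ((nbwAvoidTo (insert b A) (b - stepVec g) m).card : ℝ) * β ^ m)
      fun _ k => ((nbwAvoidToFirst (tabooShiftBy A b) (x - b) (srev g) k).card : ℝ) * β ^ k).symm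
  rw [heq] at h1
  exact tendsto_nhds_unique h1 h2

/-- `b − e_g ∉ A` says that `−e_g` is not in the translated obstacle `A − b`.
[cite: HaraSladeSokal1993, §3.2 eq. (3.12)–(3.13) p. 18 (lane plumbing)] -/
theorem stepVec_srev_notMem_tabooShiftBy {A : Finset (Site d)} {b : Site d} {g : Dir d}
    (h : b - stepVec g ∉ A) : stepVec (srev g) ∉ tabooShiftBy A b := by
  rw [mem_tabooShiftBy, stepVec_srev]
  intro h'
  apply h
  convert h' using 2
  abel

/-- **Hara–Slade–Sokal (3.13):** for `0 ≤ β ≤ 1/(2d−1)`, `d ≥ 3`, `b ≠ 0`, `b ∉ A` and `b − e_g ∉ A` for every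
direction `g`,
`(1−β²)·C^A₂(0,x;β) = (1−β²)·C^{A∪{b}}₂(0,x;β) + β Σ_g C^{A∪{b}}₂(0,b−e_g;β)·[C^{A−b}₂(0,x−b;β) − β C^{A−b+e_g}₂(0,x−b+e_g;β)]`
— AS PRINTED "C^{A∪{b}}₂(y,x;β) = C^A₂(y,x;β) − (β/(1−β²)) Σ_{f} C^{A∪{b}}₂(y,b+f;β)[C^A₂(b,x;β) − βC^A₂(b+f,x;β)]"
with `y = 0`, `f = −g`, the functions of the bracket translated to start at the origin.
[cite: HaraSladeSokal1993, §3.2 eq. (3.13) p. 18] -/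
theorem hss_tabooGF_insert (hd : 3 ≤ d) {A : Finset (Site d)} {b : Site d} (hb0 : b ≠ 0) (hbA : b ∉ A)
    (hbg : ∀ g : Dir d, b - stepVec g ∉ A) (x : Site d) {β : ℝ} (hβ : 0 ≤ β) (hβc : β ≤ 1 / (2 * d - 1)) :
    (1 - β ^ 2) * tabooGF A x β = (1 - β ^ 2) * tabooGF (insert b A) x β +
      β * ∑ g : Dir d, tabooGF (insert b A) (b - stepVec g) β *
        (tabooGF (tabooShiftBy A b) (x - b) β -
          β * tabooGF (tabooShift (tabooShiftBy A b) (srev g)) (x - b - stepVec (srev g)) β) := by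
  have h0' : (0 : Site d) ∉ tabooShiftBy A b := by rwa [zero_mem_tabooShiftBy_iff]
  have h := tabooGF_eq_insert_add hd hb0 hbA x hβ hβc
  have hN : ∀ g : Dir d, (1 - β ^ 2) * tabooFirstGF (tabooShiftBy A b) (x - b) (srev g) β =
      tabooGF (tabooShiftBy A b) (x - b) β -
        β * tabooGF (tabooShift (tabooShiftBy A b) (srev g)) (x - b - stepVec (srev g)) β := fun g =>
    hss_tabooFirstGF_eq hd h0' (stepVec_srev_notMem_tabooShiftBy (hbg g)) (x - b) hβ hβc
  rw [h, mul_add, Finset.mul_sum, Finset.mul_sum, Finset.mul_sum]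
  congr 1
  refine Finset.sum_congr rfl fun g _ => ?_
  rw [← hN g]
  ring

/-! ### No obstacle and one excluded neighbour: the system for `C^{e_t}₂(0,·;β)` -/

/-- `∅ − b = ∅`. [cite: HaraSladeSokal1993, §3.2 p. 17 ("C₂ ≡ C^∅₂"; lane plumbing)] -/
theorem tabooShiftBy_empty (b : Site d) : tabooShiftBy (∅ : Finset (Site d)) b = ∅ := by
  classical
  exact Finset.image_empty _

/-- `∅ − e_f = ∅`. [cite: HaraSladeSokal1993, §3.2 p. 17 ("C₂ ≡ C^∅₂"; lane plumbing)] -/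
theorem tabooShift_empty (f : Dir d) : tabooShift (∅ : Finset (Site d)) f = ∅ := by
  classical
  exact Finset.image_empty _

/-- **(3.13) with no obstacle and `b = e_t`:** for `0 ≤ β ≤ 1/(2d−1)`, `d ≥ 3`,
`(1−β²)·B_β(x) = (1−β²)·C^{e_t}₂(0,x;β) + β Σ_g C^{e_t}₂(0,e_t−e_g;β)·[B_β(x−e_t) − β·B_β(x−e_t+e_g)]`
with `B_β = nbwGen d β` the non-backtracking two-point series (`C^∅₂`): (3.13) with `A = ∅`, `y = 0`, `b = e_t`,
`f = −g`. AS PRINTED: "for a fixed `y`, (3.13) provides a systems of `2d` linear equations for `2d` unknowns,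
namely `{C^{A∪{b}}₂(y,b+f;β)}_{|f|=1}`" — here, taking `x ∈ {e_t − e_g : g}`, for the `2d` numbers
`C^{e_t}₂(0,e_t−e_g;β)`; then `x = 0` and `x = e_s` give `C^{e_t}₂(0,0;β)` and `C^{e_t}₂(0,e_s;β)`.
[cite: HaraSladeSokal1993, §3.2 eq. (3.13) p. 18] -/
theorem tabooGF_singleton_eq (hd : 3 ≤ d) (t : Dir d) (x : Site d) {β : ℝ} (hβ : 0 ≤ β)
    (hβc : β ≤ 1 / (2 * d - 1)) :
    (1 - β ^ 2) * nbwGen d β x = (1 - β ^ 2) * tabooGF {stepVec t} x β +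
      β * ∑ g : Dir d, tabooGF {stepVec t} (stepVec t - stepVec g) β *
        (nbwGen d β (x - stepVec t) - β * nbwGen d β (x - stepVec t + stepVec g)) := by
  have h := hss_tabooGF_insert hd (stepVec_ne_zero t) (Finset.notMem_empty _)
    (fun g => Finset.notMem_empty _) x hβ hβc
  rw [tabooGF_empty_eq_nbwGen, Finset.insert_empty] at h
  · rw [h]
    congr 1
    congr 1
    refine Finset.sum_congr rfl fun g _ => ?_
    rw [tabooShiftBy_empty, tabooShift_empty, tabooGF_empty_eq_nbwGen, tabooGF_empty_eq_nbwGen, stepVec_srev,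
      sub_neg_eq_add]

/-- **(3.18) with `A = {e_t}`, the `W` of the (2̃,1) bound:** for `s ≠ t`, `0 ≤ β ≤ 1/(2d−1)`, `d ≥ 3`,
`(1−β²)·C̃^{{e_t};e_s}₂(0,0;β) = C^{e_t}₂(0,0;β) − β·C^{e_t}₂(0,e_s;β)`; the left side is the series of the
memory-2 engine's penalised loop counts `#closedNbwPen {e_t} s σ` (`SAWLoopErasureMemoryTwo`).
[cite: HaraSladeSokal1993, §3.3 eq. (3.18) p. 19 with §2.4 eq. (2.36)–(2.39) p. 10–11] -/
theorem penGF_singleton_eq (hd : 3 ≤ d) {t s : Dir d} (hts : s ≠ t) {β : ℝ} (hβ : 0 ≤ β)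
    (hβc : β ≤ 1 / (2 * d - 1)) :
    (1 - β ^ 2) * penGF {stepVec t} s β = tabooGF {stepVec t} 0 β - β * tabooGF {stepVec t} (stepVec s) β := by
  refine hss_penGF_eq hd ?_ ?_ hβ hβc
  · rw [Finset.mem_singleton]
    exact fun h => stepVec_ne_zero t h.symm
  · rw [Finset.mem_singleton]
    exact fun h => hts (stepVec_injective h)

/-- The partial sums of the penalised loop series are bounded by its sum (nonnegative terms): the form in which
`penGF` feeds a `W` to `hss_memoryTwo_div_le_connectiveConstant`-type bounds.
[cite: HaraSladeSokal1993, §2.4 eq. (2.37)–(2.39) p. 10–11 with §3.3 (3.18) p. 19] -/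
theorem sum_range_card_closedNbwPen_le_penGF (hd : 3 ≤ d) (A : Finset (Site d)) (s : Dir d) {β : ℝ}
    (hβ : 0 ≤ β) (hβc : β ≤ 1 / (2 * d - 1)) (K : ℕ) :
    ∑ σ ∈ range K, ((closedNbwPen A s σ).card : ℝ) * β ^ σ ≤ penGF A s β :=
  (summable_card_closedNbwPen_mul_pow hd A s hβ hβc).sum_le_tsum (range K)
    fun σ _ => mul_nonneg (Nat.cast_nonneg _) (pow_nonneg hβ σ)

end Literature.Probability.RandomPlanarGeometry.SAW.Zd.LoopErasure

end
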